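import Mathlib
import Summits.NavierStokesRegularity.NavierStokesRegularity.Theorems.FilamentSkeletonRssStadiumCornerRightDescentFar

/-!
# Route `FilamentSkeletonRss` · child crux `TangentSkeletonNearStraightL` (stmt-NavierStokesRegularity-23320) · registered line
# `child_tangent_analytic_strip_L` (b0b56c52900dd90a), stub `stub_stripPropagation` — assembly: QUANTITATIVE MARGINS OF THE TWO-FEET CERTIFICATES

The corner certificates of this chain were landed in POSITIVITY form (`0 < Re(q + κG)`) — what the branch/holomorphy step of the contour
shift needs.  The BOUND step of the retyped blueprint (`Theorems.StadiumOwnContourBound` analogue: `|q + κG|^{-3/2}` integrated along the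
contour) needs the margins themselves.  This file re-exports the two-feet family with its gap: `two_feet_re_ge_of_num` (general position,
free admissible source-leg radius, gap `g`: `g² ≤ Re q`), `foot_reduce_le`, `far_piece_ge` (+ the three decimal intervals), and
  `corner_right_descent_far_re_ge` — `(0.007·hs)² ≤ Re Σᵢ (Fᵢ(ζ(f)) − Fᵢ(z))²` for the far descent `11/20 ≤ f ≤ 1`.
(The far sources' and the variance family's margins: `Theorems.StadiumCornerQuantFar`, `Theorems.StadiumCornerQuantVariance`.)  Same proofs as the positivity versions with the gap carried.
HONEST FRAMING: bookkeeping for a HYPOTHETICAL filament skeleton on the NEGATIVE side of a MODEL route; the stub `stub_stripPropagation` is NOT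
closed by this file; nothing here bears on Navier–Stokes regularity or blow-up.  `--supports stmt-NavierStokesRegularity-23320`.
-/

set_option linter.dupNamespace false

noncomputable section

namespace Summit.NavierStokesRegularity.NavierStokesRegularity.Theorems.StadiumCornerQuantFeet

open Set MeasureTheory
open scoped InnerProductSpace BigOperators
open Summit.NavierStokesRegularity.NavierStokesRegularity.Theorems.StadiumCornerRightFoot
open Summit.NavierStokesRegularity.NavierStokesRegularity.Theorems.StadiumCornerRightDescentFoot
open Summit.NavierStokesRegularity.NavierStokesRegularity.Theorems.StadiumCornerRightDescentFar
open Summit.NavierStokesRegularity.NavierStokesRegularity.Theorems.StadiumFootClosedForm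
open Summit.NavierStokesRegularity.NavierStokesRegularity.Theorems.StadiumChordProjection

/-- **The two-feet estimate for a source to the right of the target, reduced to one number (general position).**  Stadium `S = {|Im| < hs, |Re − cc| < L + hs}`,
`F` holomorphic on `S` with `‖F′‖ ≤ 2`, `Σ (F′)ᵢ² = 1`, `F = cplx ∘ X` on the real trace, `X` of class `C¹` with unit speed and tangent
oscillation `≤ Rb ≤ 1/2`; target `z = x₀ + iY` (`0 ≤ Y < hs/4`, target-leg radius `3hs/4` admissible: `|x₀ − cc| + 3hs/4 < L + hs`); source `ζ = (x₀ + a) + iη` with `0 < a`,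
`0 ≤ η ≤ ηs < 3hs/4 − a =: R₂`; a bound `(Y−η)² + Yη/4 ≤ Ss`; core term `0 < κ`, `0 < g₀ ≤ Re G`.  QUANTITATIVE form: if
`√Ss + 0.0389hs + √3·4(ηs − (R₂−ηs)ℓ − ηs²/(2R₂)) + g ≤ (7/8)a − 0.0398hs − 24·K(R₂,ηs) − ½·√3·2(ηs − (R₂−ηs)ℓ)` (`ℓ = log(R₂/(R₂−ηs))`,
`K` the `J`-closed form, `g ≥ 0` the gap), then `g² ≤ Re Σᵢ (Fᵢ(ζ) − Fᵢ(z))²`. [folklore] -/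
theorem two_feet_re_ge_of_num {hs L cc : ℝ} {F : ℂ → (Fin 3 → ℂ)}
    (hF : DifferentiableOn ℂ F {z : ℂ | |z.im| < hs ∧ |z.re - cc| < L + hs})
    (hM : ∀ z ∈ {z : ℂ | |z.im| < hs ∧ |z.re - cc| < L + hs}, ‖deriv F z‖ ≤ 2)
    (hunit : ∀ w ∈ {z : ℂ | |z.im| < hs ∧ |z.re - cc| < L + hs}, ∑ i, (deriv F w i) ^ 2 = 1)
    {X : ℝ → EuclideanSpace ℝ (Fin 3)} (hX : ContDiff ℝ 1 X) (hXu : ∀ τ, ‖deriv X τ‖ = 1)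
    {Rb : ℝ} (hRb0 : 0 ≤ Rb) (hRb : Rb ≤ 1 / 2) (hosc : ∀ τ σ, ‖deriv X τ - deriv X σ‖ ≤ Rb)
    (hFX : ∀ r : ℝ, (r : ℂ) ∈ {z : ℂ | |z.im| < hs ∧ |z.re - cc| < L + hs} →
      F r = fun i => ((⟪X r, EuclideanSpace.single i (1:ℝ)⟫_ℝ : ℝ) : ℂ))
    (hhs : 0 < hs) {x₀ Y a η ηs Ss R₂ g : ℝ} (hg : 0 ≤ g) (hY0 : 0 ≤ Y) (hY : Y < hs / 4) (hR₁end : |x₀ - cc| + 3 * hs / 4 < L + hs)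
    (ha0 : 0 < a) (hR₂pos : 0 < R₂) (hR₂hs : R₂ < hs) (hR₂end : |x₀ + a - cc| + R₂ < L + hs) (hη0 : 0 ≤ η) (hηs : η ≤ ηs) (hηsR : ηs < R₂)
    (hSs : (Y - η) ^ 2 + Y * η / 4 ≤ Ss)
    (hnum : √Ss + 0.0389 * hs +
        √3 * (2 * 2 * (ηs - (R₂ - ηs) * Real.log (R₂ / (R₂ - ηs)) -
          ηs ^ 2 / (2 * R₂))) + g ≤
      7 / 8 * a - 0.0398 * hs -
        (6 * (2:ℝ) ^ 2 * (2 * ηs - (R₂ - ηs) * Real.log (R₂ / (R₂ - ηs)) ^ 2 -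
            2 * (R₂ - ηs) * Real.log (R₂ / (R₂ - ηs)) +
            (R₂ ^ 2 - ηs ^ 2) * Real.log (R₂ / (R₂ - ηs)) / (2 * R₂) -
            ηs / 2 - ηs ^ 2 / (4 * R₂)) +
          1 / 2 * (√3 * (2 * (ηs - (R₂ - ηs) * Real.log (R₂ / (R₂ - ηs)))))))
    :
    g ^ 2 ≤ (∑ i, (F (((x₀ + a : ℝ) : ℂ) + (η : ℂ) * Complex.I) i - F ((x₀ : ℂ) + (Y : ℂ) * Complex.I) i) ^ 2).re := by
  have hXd : Differentiable ℝ X := hX.differentiable (by norm_num)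
  -- the mixed term (small context first)
  have hRb2 : Rb ^ 2 ≤ 1 / 4 := by nlinarith
  have hmix : √((Y - η) ^ 2 + Y * η * Rb ^ 2) ≤ √Ss := by
    apply Real.sqrt_le_sqrt
    have hYη : 0 ≤ Y * η := mul_nonneg hY0 hη0
    have h1 : Y * η * Rb ^ 2 ≤ Y * η * (1 / 4) := mul_le_mul_of_nonneg_left hRb2 hYη
    linarith only [h1, hSs]
  have hmix0 : 0 ≤ √((Y - η) ^ 2 + Y * η * Rb ^ 2) := Real.sqrt_nonneg _
  -- radii
  have hR₁Y : Y < 3 * hs / 4 := by linarith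
  have hR₁hs : 3 * hs / 4 < hs := by linarith
  have hηR₂ : η < R₂ := lt_of_le_of_lt hηs hηsR
  have hηs0 : 0 ≤ ηs := hη0.trans hηs
  -- chord projection `c₀ = (1 − Rb²/2)·a ≥ (7/8)a`
  have hc₀ := chord_proj_coords_ge hX hXu hosc (x₁ := x₀) (x₂ := x₀ + a) (by linarith)
  have hc₀' : 7 / 8 * a ≤ (1 - Rb ^ 2 / 2) * (x₀ + a - x₀) := by
    have e : x₀ + a - x₀ = a := by ring
    rw [e]
    have h1 : 7 / 8 ≤ 1 - Rb ^ 2 / 2 := by nlinarith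
    nlinarith
  -- target leg numbers
  have hI₁ := corner_I_le hhs hY0 hY.le
  have hJ₁ := corner_J_le hhs hY0 hY.le
  have hI₁0 : 0 ≤ √3 * (2 * 2 * (Y - (3 * hs / 4 - Y) * Real.log (3 * hs / 4 / (3 * hs / 4 - Y)) - Y ^ 2 / (2 * (3 * hs / 4)))) := by
    have h := legI_closed_mono (M := 2) (R := 3 * hs / 4) (t₁ := 0) (t₂ := Y) (by norm_num) le_rfl hY0 hR₁Y
    have e : √3 * (2 * 2 * (0 - (3 * hs / 4 - 0) * Real.log (3 * hs / 4 / (3 * hs / 4 - 0)) - 0 ^ 2 / (2 * (3 * hs / 4)))) = 0 := by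
      rw [sub_zero, div_self (by positivity : (3 * hs / 4) ≠ 0), Real.log_one]; ring
    rw [e] at h
    exact h
  -- source leg: monotone in the height up to `ηs`
  have hI₂ := legI_closed_mono (M := 2) (R := R₂) (by norm_num) hη0 hηs hηsR
  have hI₂0 : 0 ≤ √3 * (2 * 2 * (η - (R₂ - η) * Real.log (R₂ / (R₂ - η)) -
      η ^ 2 / (2 * R₂))) := by
    have h := legI_closed_mono (M := 2) (R := R₂) (t₁ := 0) (t₂ := η) (by norm_num) le_rfl hη0 hηR₂
    have e : √3 * (2 * 2 * (0 - (R₂ - 0) * Real.log (R₂ / (R₂ - 0)) -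
        0 ^ 2 / (2 * R₂))) = 0 := by
      rw [sub_zero, div_self (ne_of_gt hR₂pos), Real.log_one]; ring
    rw [e] at h
    exact h
  have hJ₂ := legJ_closed_mono (M := 2) (R := R₂) hη0 hηs hηsR
  have hQ₂ := legQ_closed_mono (M := 2) (R := R₂) (by norm_num) hη0 hηs hηsR
  have hQ₂0 : 0 ≤ √3 * (2 * (η - (R₂ - η) * Real.log (R₂ / (R₂ - η)))) := by
    have h := legQ_closed_mono (M := 2) (R := R₂) (t₁ := 0) (t₂ := η) (by norm_num) le_rfl hη0 hηR₂
    have e : √3 * (2 * (0 - (R₂ - 0) * Real.log (R₂ / (R₂ - 0)))) = 0 := by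
      rw [sub_zero, div_self (ne_of_gt hR₂pos), Real.log_one]; ring
    rw [e] at h
    exact h
  -- atomise all closed forms
  generalize hCv : (1 - Rb ^ 2 / 2) * (x₀ + a - x₀) = Cv at hc₀ hc₀'
  generalize hJ1v : 6 * (2:ℝ) ^ 2 * (2 * Y - (3 * hs / 4 - Y) * Real.log (3 * hs / 4 / (3 * hs / 4 - Y)) ^ 2 -
        2 * (3 * hs / 4 - Y) * Real.log (3 * hs / 4 / (3 * hs / 4 - Y)) +
        ((3 * hs / 4) ^ 2 - Y ^ 2) * Real.log (3 * hs / 4 / (3 * hs / 4 - Y)) / (2 * (3 * hs / 4)) - Y / 2 -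
        Y ^ 2 / (4 * (3 * hs / 4))) = J1v at hJ₁
  generalize hI1v : √3 * (2 * 2 * (Y - (3 * hs / 4 - Y) * Real.log (3 * hs / 4 / (3 * hs / 4 - Y)) -
      Y ^ 2 / (2 * (3 * hs / 4)))) = I1v at hI₁ hI₁0
  generalize hJ2v : 6 * (2:ℝ) ^ 2 * (2 * η - (R₂ - η) * Real.log (R₂ / (R₂ - η)) ^ 2 -
        2 * (R₂ - η) * Real.log (R₂ / (R₂ - η)) +
        (R₂ ^ 2 - η ^ 2) * Real.log (R₂ / (R₂ - η)) / (2 * R₂) -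
        η / 2 - η ^ 2 / (4 * R₂)) = J2v at hJ₂
  generalize hJ2s : 6 * (2:ℝ) ^ 2 * (2 * ηs - (R₂ - ηs) * Real.log (R₂ / (R₂ - ηs)) ^ 2 -
        2 * (R₂ - ηs) * Real.log (R₂ / (R₂ - ηs)) +
        (R₂ ^ 2 - ηs ^ 2) * Real.log (R₂ / (R₂ - ηs)) / (2 * R₂) -
        ηs / 2 - ηs ^ 2 / (4 * R₂)) = J2s at hJ₂ hnum
  generalize hI2v : √3 * (2 * 2 * (η - (R₂ - η) * Real.log (R₂ / (R₂ - η)) -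
      η ^ 2 / (2 * R₂))) = I2v at hI₂ hI₂0
  generalize hI2s : √3 * (2 * 2 * (ηs - (R₂ - ηs) * Real.log (R₂ / (R₂ - ηs)) -
      ηs ^ 2 / (2 * R₂))) = I2s at hI₂ hnum
  generalize hQ2v : √3 * (2 * (η - (R₂ - η) * Real.log (R₂ / (R₂ - η)))) = Q2v at hQ₂ hQ₂0
  generalize hQ2s : √3 * (2 * (ηs - (R₂ - ηs) * Real.log (R₂ / (R₂ - ηs)))) = Q2s
    at hQ₂ hnum
  generalize hMv : √((Y - η) ^ 2 + Y * η * Rb ^ 2) = Mv at hmix hmix0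
  -- the Rb-term of `J₂`
  have hRbQ : Rb * Q2v ≤ 1 / 2 * Q2s := by
    calc Rb * Q2v ≤ Rb * Q2s := mul_le_mul_of_nonneg_left hQ₂ hRb0
      _ ≤ 1 / 2 * Q2s := mul_le_mul_of_nonneg_right hRb (hQ₂0.trans hQ₂)
  have hRbQ0 : 0 ≤ Rb * Q2v := mul_nonneg hRb0 hQ₂0
  have hJ₂0' : J2v ≤ J2s := hJ₂
  -- the gap
  have hSs0 : 0 ≤ √Ss := Real.sqrt_nonneg _
  have ha' : 0 ≤ Cv - J1v - (J2v + Rb * Q2v) := by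
    linarith only [hSs0, hnum, hc₀', hJ₁, hJ₂0', hRbQ, hI₁0, hI₂0, hI₂, hhs, hg]
  have h := foot_re_ge_closed_form (M := 2) hF hM hunit hXd hXu hosc hFX hhs hY0 hη0 hR₁Y hR₁hs hR₁end hηR₂ hR₂hs hR₂end hc₀
    (by rw [hJ1v, hJ2v, hQ2v]; exact ha')
  rw [hJ1v, hJ2v, hQ2v, hI1v, hI2v, hMv] at h
  have hB0 : 0 ≤ Mv + I1v + I2v := by linarith only [hmix0, hI₁0, hI₂0]
  have hgap : Mv + I1v + I2v + g ≤ Cv - J1v - (J2v + Rb * Q2v) := by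
    linarith only [hSs0, hnum, hc₀', hJ₁, hJ₂0', hRbQ, hI₁, hI₂, hmix, hhs]
  have hsq : g ^ 2 ≤ (Cv - J1v - (J2v + Rb * Q2v)) ^ 2 - (Mv + I1v + I2v) ^ 2 := by
    have e : (Cv - J1v - (J2v + Rb * Q2v)) ^ 2 - (Mv + I1v + I2v) ^ 2 =
        ((Cv - J1v - (J2v + Rb * Q2v)) - (Mv + I1v + I2v)) * ((Cv - J1v - (J2v + Rb * Q2v)) + (Mv + I1v + I2v)) := by ring
    rw [e, pow_two]
    exact mul_le_mul (by linarith only [hgap]) (by linarith only [hgap, hB0]) hg (by linarith only [hgap, hg])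
  have hsym : (∑ i, (F (((x₀ + a : ℝ) : ℂ) + (η : ℂ) * Complex.I) i - F ((x₀ : ℂ) + (Y : ℂ) * Complex.I) i) ^ 2) =
      ∑ i, (F ((x₀ : ℂ) + (Y : ℂ) * Complex.I) i - F (((x₀ + a : ℝ) : ℂ) + (η : ℂ) * Complex.I) i) ^ 2 :=
    Finset.sum_congr rfl fun i _ => by ring
  rw [hsym]
  push_cast at h ⊢
  linarith only [h, hsq]

/-- **Reduction of the two-feet inequality to decimals.**  With `e < r`, `0 < r`, `0 ≤ ℓ₀ ≤ ℓ`, `0 ≤ e − (r−e)ℓ₀ − e²/(2r)`: the three smears are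
antitone in `ℓ` and `√3 ≤ 1.73206`, so the decimal inequality at `ℓ₀` (with a gap `g`) implies the tool's inequality at `ℓ` (same gap). [folklore] -/
theorem foot_reduce_le {r e ℓ ℓ₀ P M g : ℝ} (hr : 0 < r) (her : e < r) (hℓ₀ : 0 ≤ ℓ₀) (hℓ : ℓ₀ ≤ ℓ)
    (hB : 0 ≤ e - (r - e) * ℓ₀ - e ^ 2 / (2 * r))
    (hnum : P + 4 * 1.73206 * (e - (r - e) * ℓ₀ - e ^ 2 / (2 * r)) + g ≤
      M - 24 * (2 * e - (r - e) * ℓ₀ ^ 2 - 2 * (r - e) * ℓ₀ + (r ^ 2 - e ^ 2) * ℓ₀ / (2 * r) - e / 2 - e ^ 2 / (4 * r)) -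
        1.73206 * (e - (r - e) * ℓ₀)) :
    P + √3 * (2 * 2 * (e - (r - e) * ℓ - e ^ 2 / (2 * r))) + g ≤
      M - (6 * (2:ℝ) ^ 2 * (2 * e - (r - e) * ℓ ^ 2 - 2 * (r - e) * ℓ + (r ^ 2 - e ^ 2) * ℓ / (2 * r) - e / 2 - e ^ 2 / (4 * r)) +
        1 / 2 * (√3 * (2 * (e - (r - e) * ℓ)))) := by
  have hs3 : Real.sqrt 3 ≤ 1.73206 := by rw [Real.sqrt_le_left (by norm_num)]; norm_num
  have hs30 : 0 ≤ Real.sqrt 3 := Real.sqrt_nonneg 3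
  have hre : 0 ≤ r - e := by linarith
  have hdl : 0 ≤ ℓ - ℓ₀ := by linarith
  -- the `I` and `Q` brackets are antitone in `ℓ`
  have hBI : e - (r - e) * ℓ - e ^ 2 / (2 * r) ≤ e - (r - e) * ℓ₀ - e ^ 2 / (2 * r) := by
    nlinarith [mul_nonneg hre hdl]
  have hBq : e - (r - e) * ℓ ≤ e - (r - e) * ℓ₀ := by nlinarith [mul_nonneg hre hdl]
  have hBq0 : 0 ≤ e - (r - e) * ℓ₀ := by
    have : 0 ≤ e ^ 2 / (2 * r) := by positivity
    linarith
  -- the `J` bracket is antitone in `ℓ`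
  have hK : 2 * e - (r - e) * ℓ ^ 2 - 2 * (r - e) * ℓ + (r ^ 2 - e ^ 2) * ℓ / (2 * r) - e / 2 - e ^ 2 / (4 * r) ≤
      2 * e - (r - e) * ℓ₀ ^ 2 - 2 * (r - e) * ℓ₀ + (r ^ 2 - e ^ 2) * ℓ₀ / (2 * r) - e / 2 - e ^ 2 / (4 * r) := by
    have e1 : (2 * e - (r - e) * ℓ ^ 2 - 2 * (r - e) * ℓ + (r ^ 2 - e ^ 2) * ℓ / (2 * r) - e / 2 - e ^ 2 / (4 * r)) -
        (2 * e - (r - e) * ℓ₀ ^ 2 - 2 * (r - e) * ℓ₀ + (r ^ 2 - e ^ 2) * ℓ₀ / (2 * r) - e / 2 - e ^ 2 / (4 * r)) =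
        -((ℓ - ℓ₀) * (r - e) * ((ℓ + ℓ₀) + 2 - (r + e) / (2 * r))) := by
      field_simp
      ring
    have h1 : (r + e) / (2 * r) ≤ 1 := by rw [div_le_one (by positivity)]; linarith
    have hbr : 0 ≤ (ℓ + ℓ₀) + 2 - (r + e) / (2 * r) := by linarith
    have hprod : 0 ≤ (ℓ - ℓ₀) * (r - e) * ((ℓ + ℓ₀) + 2 - (r + e) / (2 * r)) :=
      mul_nonneg (mul_nonneg hdl hre) hbr
    linarith
  -- chain
  have h1 : √3 * (2 * 2 * (e - (r - e) * ℓ - e ^ 2 / (2 * r))) ≤ 1.73206 * (2 * 2 * (e - (r - e) * ℓ₀ - e ^ 2 / (2 * r))) := by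
    calc √3 * (2 * 2 * (e - (r - e) * ℓ - e ^ 2 / (2 * r))) ≤ √3 * (2 * 2 * (e - (r - e) * ℓ₀ - e ^ 2 / (2 * r))) :=
          mul_le_mul_of_nonneg_left (by linarith) hs30
      _ ≤ 1.73206 * (2 * 2 * (e - (r - e) * ℓ₀ - e ^ 2 / (2 * r))) := mul_le_mul_of_nonneg_right hs3 (by linarith)
  have h2 : 1 / 2 * (√3 * (2 * (e - (r - e) * ℓ))) ≤ 1.73206 * (e - (r - e) * ℓ₀) := by
    have e2 : 1 / 2 * (√3 * (2 * (e - (r - e) * ℓ))) = √3 * (e - (r - e) * ℓ) := by ring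
    rw [e2]
    calc √3 * (e - (r - e) * ℓ) ≤ √3 * (e - (r - e) * ℓ₀) := mul_le_mul_of_nonneg_left hBq hs30
      _ ≤ 1.73206 * (e - (r - e) * ℓ₀) := mul_le_mul_of_nonneg_right hs3 hBq0
  have h3 : 6 * (2:ℝ) ^ 2 * (2 * e - (r - e) * ℓ ^ 2 - 2 * (r - e) * ℓ + (r ^ 2 - e ^ 2) * ℓ / (2 * r) - e / 2 - e ^ 2 / (4 * r)) ≤
      24 * (2 * e - (r - e) * ℓ₀ ^ 2 - 2 * (r - e) * ℓ₀ + (r ^ 2 - e ^ 2) * ℓ₀ / (2 * r) - e / 2 - e ^ 2 / (4 * r)) := by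
    rw [show (6 * (2:ℝ) ^ 2) = 24 by norm_num]
    exact mul_le_mul_of_nonneg_left hK (by norm_num)
  linarith

/-- **The generic interval step of the far descent.**  Stadium hypotheses as in the two-feet tool; `f ∈ [f₁, f₂] ⊆ [1/8, 1]`; decimal data
`r = 3/4 − (1/5 + 3f₂/10)` (source-leg radius `/hs`), `e = (1 − f₁)/4` (worst source height `/hs`), `q ≥ 0` with `(f₂² + (1−f₂)/4)/16 ≤ q²`
(worst mixed term), `0 ≤ ℓ₀ ≤ log(r/(r−e))`, and the decimal inequality of `foot_reduce_le` with `P = q + 0.0389`,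
`M = (7/8)(1/5 + 3f₁/10) − 0.0398` and gap `δ ≥ 0`: then `(δ·hs)² ≤ Re Σᵢ (Fᵢ(ζ(f)) − Fᵢ(z))²`. [folklore] -/
theorem far_piece_ge {hs L cc : ℝ} {F : ℂ → (Fin 3 → ℂ)}
    (hF : DifferentiableOn ℂ F {z : ℂ | |z.im| < hs ∧ |z.re - cc| < L + hs})
    (hM : ∀ z ∈ {z : ℂ | |z.im| < hs ∧ |z.re - cc| < L + hs}, ‖deriv F z‖ ≤ 2)
    (hunit : ∀ w ∈ {z : ℂ | |z.im| < hs ∧ |z.re - cc| < L + hs}, ∑ i, (deriv F w i) ^ 2 = 1)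
    {X : ℝ → EuclideanSpace ℝ (Fin 3)} (hX : ContDiff ℝ 1 X) (hXu : ∀ τ, ‖deriv X τ‖ = 1)
    {Rb : ℝ} (hRb0 : 0 ≤ Rb) (hRb : Rb ≤ 1 / 2) (hosc : ∀ τ σ, ‖deriv X τ - deriv X σ‖ ≤ Rb)
    (hFX : ∀ r : ℝ, (r : ℂ) ∈ {z : ℂ | |z.im| < hs ∧ |z.re - cc| < L + hs} →
      F r = fun i => ((⟪X r, EuclideanSpace.single i (1:ℝ)⟫_ℝ : ℝ) : ℂ))
    (hhs : 0 < hs) {x₀ Y f f₁ f₂ r e q ℓ₀ δ : ℝ} (hδ : 0 ≤ δ) (hY0 : 0 ≤ Y) (hY : Y < hs / 4) (hx₀ : x₀ < cc + L + hs / 4) (hx₀cc : cc ≤ x₀)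
    (hf₁8 : 1 / 8 ≤ f₁) (hf1 : f₁ ≤ f) (hf2 : f ≤ f₂) (hf₂1 : f₂ ≤ 1)
    (hrdef : r = 3 / 4 - (1 / 5 + 3 / 10 * f₂)) (hedef : e = (1 - f₁) / 4) (hr0 : 0 < r) (her : e < r)
    (hq0 : 0 ≤ q) (hq : (f₂ ^ 2 + (1 - f₂) / 4) / 16 ≤ q ^ 2)
    (hℓ₀ : 0 ≤ ℓ₀) (hℓ₀ℓ : ℓ₀ ≤ Real.log (r / (r - e)))
    (hB : 0 ≤ e - (r - e) * ℓ₀ - e ^ 2 / (2 * r))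
    (hnum : q + 0.0389 + 4 * 1.73206 * (e - (r - e) * ℓ₀ - e ^ 2 / (2 * r)) + δ ≤
      7 / 8 * (1 / 5 + 3 / 10 * f₁) - 0.0398 -
        24 * (2 * e - (r - e) * ℓ₀ ^ 2 - 2 * (r - e) * ℓ₀ + (r ^ 2 - e ^ 2) * ℓ₀ / (2 * r) - e / 2 - e ^ 2 / (4 * r)) -
        1.73206 * (e - (r - e) * ℓ₀))
    :
    (δ * hs) ^ 2 ≤ (∑ i, (F (((x₀ + (hs / 5 + 3 * hs / 10 * f) : ℝ) : ℂ) + ((Y * (1 - f) : ℝ) : ℂ) * Complex.I) i -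
        F ((x₀ : ℂ) + (Y : ℂ) * Complex.I) i) ^ 2).re := by
  have he0 : 0 ≤ e := by rw [hedef]; linarith
  have ha0 : 0 < hs / 5 + 3 * hs / 10 * f := by
    have : 0 ≤ hs * f := mul_nonneg hhs.le (by linarith)
    linarith only [this, hhs]
  have hR₂pos : 0 < hs * r := mul_pos hhs hr0
  have hR₂le : hs * r ≤ 3 * hs / 4 - (hs / 5 + 3 * hs / 10 * f) := by
    have := mul_le_mul_of_nonneg_left hf2 hhs.le
    rw [hrdef]; linarith only [this]
  have hη0 : 0 ≤ Y * (1 - f) := mul_nonneg hY0 (by linarith)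
  have hηs : Y * (1 - f) ≤ hs * e := by
    rw [hedef]
    have h1 : Y * (1 - f) ≤ Y * (1 - f₁) := mul_le_mul_of_nonneg_left (by linarith) hY0
    have h2 : Y * (1 - f₁) ≤ hs / 4 * (1 - f₁) := mul_le_mul_of_nonneg_right hY.le (by linarith)
    linarith
  have hηsR : hs * e < hs * r := mul_lt_mul_of_pos_left her hhs
  have hSs : (Y - Y * (1 - f)) ^ 2 + Y * (Y * (1 - f)) / 4 ≤ (q * hs) ^ 2 := by
    have e1 : (Y - Y * (1 - f)) ^ 2 + Y * (Y * (1 - f)) / 4 = Y ^ 2 * (f ^ 2 + (1 - f) / 4) := by ring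
    rw [e1]
    have hc : f ^ 2 + (1 - f) / 4 ≤ f₂ ^ 2 + (1 - f₂) / 4 := by
      have : 0 ≤ (f₂ - f) * (f₂ + f - 1 / 4) := mul_nonneg (by linarith) (by linarith)
      nlinarith
    have hY2 : Y ^ 2 ≤ (hs / 4) ^ 2 := pow_le_pow_left₀ hY0 hY.le 2
    have hc0 : 0 ≤ f ^ 2 + (1 - f) / 4 := by nlinarith
    calc Y ^ 2 * (f ^ 2 + (1 - f) / 4) ≤ (hs / 4) ^ 2 * (f₂ ^ 2 + (1 - f₂) / 4) :=
          mul_le_mul hY2 hc hc0 (by positivity)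
      _ = hs ^ 2 * ((f₂ ^ 2 + (1 - f₂) / 4) / 16) := by ring
      _ ≤ hs ^ 2 * q ^ 2 := mul_le_mul_of_nonneg_left hq (by positivity)
      _ = (q * hs) ^ 2 := by ring
  have hR₁end : |x₀ - cc| + 3 * hs / 4 < L + hs := by rw [abs_of_nonneg (by linarith)]; linarith
  have hr1 : r < 1 := by rw [hrdef]; linarith
  have hR₂hs : hs * r < hs := by have := mul_lt_mul_of_pos_left hr1 hhs; linarith
  have hprod := mul_le_mul_of_nonneg_left hf2 hhs.le
  have hR₂end : |x₀ + (hs / 5 + 3 * hs / 10 * f) - cc| + hs * r < L + hs := by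
    rw [abs_of_nonneg (by linarith), hrdef]; linarith
  refine two_feet_re_ge_of_num hF hM hunit hX hXu hRb0 hRb hosc hFX hhs (g := δ * hs) (by positivity) hY0 hY hR₁end ha0 hR₂pos
    hR₂hs hR₂end hη0 hηs hηsR hSs ?_
  -- the decimal inequality, scaled by `hs`
  have hlog : Real.log (hs * r / (hs * r - hs * e)) = Real.log (r / (r - e)) := by
    rw [← mul_sub, mul_div_mul_left _ _ hhs.ne']
  have hsq : √((q * hs) ^ 2) = q * hs := Real.sqrt_sq (by positivity)
  rw [hlog, hsq]
  have hred := foot_reduce_le (P := q + 0.0389) (M := 7 / 8 * (1 / 5 + 3 / 10 * f₁) - 0.0398) (g := δ) hr0 her hℓ₀ hℓ₀ℓ hB hnum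
  generalize hℓ : Real.log (r / (r - e)) = ℓ at hred ⊢
  have e1 : (hs * e) ^ 2 / (2 * (hs * r)) = hs * (e ^ 2 / (2 * r)) := by field_simp
  have e2 : ((hs * r) ^ 2 - (hs * e) ^ 2) * ℓ / (2 * (hs * r)) = hs * ((r ^ 2 - e ^ 2) * ℓ / (2 * r)) := by field_simp
  have e3 : (hs * e) ^ 2 / (4 * (hs * r)) = hs * (e ^ 2 / (4 * r)) := by field_simp
  rw [e1, e2, e3]
  have h1 := mul_le_mul_of_nonneg_left hred hhs.le
  have ha1 := mul_le_mul_of_nonneg_left hf1 hhs.le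
  linarith only [h1, ha1]


/-- **Far descent, interval `[11/20, 61/100]`, quantitative** (gap `0.007·hs`). [folklore] -/
theorem far_piece_ge_1 {hs L cc : ℝ} {F : ℂ → (Fin 3 → ℂ)}
    (hF : DifferentiableOn ℂ F {z : ℂ | |z.im| < hs ∧ |z.re - cc| < L + hs})
    (hM : ∀ z ∈ {z : ℂ | |z.im| < hs ∧ |z.re - cc| < L + hs}, ‖deriv F z‖ ≤ 2)
    (hunit : ∀ w ∈ {z : ℂ | |z.im| < hs ∧ |z.re - cc| < L + hs}, ∑ i, (deriv F w i) ^ 2 = 1)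
    {X : ℝ → EuclideanSpace ℝ (Fin 3)} (hX : ContDiff ℝ 1 X) (hXu : ∀ τ, ‖deriv X τ‖ = 1)
    {Rb : ℝ} (hRb0 : 0 ≤ Rb) (hRb : Rb ≤ 1 / 2) (hosc : ∀ τ σ, ‖deriv X τ - deriv X σ‖ ≤ Rb)
    (hFX : ∀ r : ℝ, (r : ℂ) ∈ {z : ℂ | |z.im| < hs ∧ |z.re - cc| < L + hs} →
      F r = fun i => ((⟪X r, EuclideanSpace.single i (1:ℝ)⟫_ℝ : ℝ) : ℂ))
    (hhs : 0 < hs) {x₀ Y f : ℝ} (hY0 : 0 ≤ Y) (hY : Y < hs / 4) (hx₀ : x₀ < cc + L + hs / 4) (hx₀cc : cc ≤ x₀)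
    (hf1 : 11 / 20 ≤ f) (hf2 : f ≤ 61 / 100) :
    (0.007 * hs) ^ 2 ≤ (∑ i, (F (((x₀ + (hs / 5 + 3 * hs / 10 * f) : ℝ) : ℂ) + ((Y * (1 - f) : ℝ) : ℂ) * Complex.I) i -
        F ((x₀ : ℂ) + (Y : ℂ) * Complex.I) i) ^ 2).re := by
  have hlog : (0.366057 : ℝ) ≤ Real.log ((367 / 1000 : ℝ) / (367 / 1000 - 9 / 80)) := by
    have h := partial_sum_le_log_div (R := (367 / 1000 : ℝ)) (t := 9 / 80) (by norm_num) (by norm_num) 8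
    simp only [Finset.sum_range_succ, Finset.sum_range_zero] at h
    norm_num at h ⊢; linarith
  exact far_piece_ge hF hM hunit hX hXu hRb0 hRb hosc hFX hhs (δ := 0.007) (by norm_num) hY0 hY hx₀ hx₀cc (f₁ := 11 / 20) (f₂ := 61 / 100)
    (r := 367 / 1000) (e := 9 / 80) (q := 857 / 5000) (ℓ₀ := 0.366057) (by norm_num) hf1 hf2 (by norm_num) (by norm_num) (by norm_num)
    (by norm_num) (by norm_num) (by norm_num) (by norm_num) (by norm_num) hlog (by norm_num) (by norm_num)

/-- **Far descent, interval `[61/100, 3/4]`, quantitative** (gap `0.007·hs`). [folklore] -/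
theorem far_piece_ge_2 {hs L cc : ℝ} {F : ℂ → (Fin 3 → ℂ)}
    (hF : DifferentiableOn ℂ F {z : ℂ | |z.im| < hs ∧ |z.re - cc| < L + hs})
    (hM : ∀ z ∈ {z : ℂ | |z.im| < hs ∧ |z.re - cc| < L + hs}, ‖deriv F z‖ ≤ 2)
    (hunit : ∀ w ∈ {z : ℂ | |z.im| < hs ∧ |z.re - cc| < L + hs}, ∑ i, (deriv F w i) ^ 2 = 1)
    {X : ℝ → EuclideanSpace ℝ (Fin 3)} (hX : ContDiff ℝ 1 X) (hXu : ∀ τ, ‖deriv X τ‖ = 1)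
    {Rb : ℝ} (hRb0 : 0 ≤ Rb) (hRb : Rb ≤ 1 / 2) (hosc : ∀ τ σ, ‖deriv X τ - deriv X σ‖ ≤ Rb)
    (hFX : ∀ r : ℝ, (r : ℂ) ∈ {z : ℂ | |z.im| < hs ∧ |z.re - cc| < L + hs} →
      F r = fun i => ((⟪X r, EuclideanSpace.single i (1:ℝ)⟫_ℝ : ℝ) : ℂ))
    (hhs : 0 < hs) {x₀ Y f : ℝ} (hY0 : 0 ≤ Y) (hY : Y < hs / 4) (hx₀ : x₀ < cc + L + hs / 4) (hx₀cc : cc ≤ x₀)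
    (hf1 : 61 / 100 ≤ f) (hf2 : f ≤ 3 / 4) :
    (0.007 * hs) ^ 2 ≤ (∑ i, (F (((x₀ + (hs / 5 + 3 * hs / 10 * f) : ℝ) : ℂ) + ((Y * (1 - f) : ℝ) : ℂ) * Complex.I) i -
        F ((x₀ : ℂ) + (Y : ℂ) * Complex.I) i) ^ 2).re := by
  have hlog : (0.356671 : ℝ) ≤ Real.log ((13 / 40 : ℝ) / (13 / 40 - 39 / 400)) := by
    have h := partial_sum_le_log_div (R := (13 / 40 : ℝ)) (t := 39 / 400) (by norm_num) (by norm_num) 8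
    simp only [Finset.sum_range_succ, Finset.sum_range_zero] at h
    norm_num at h ⊢; linarith
  exact far_piece_ge hF hM hunit hX hXu hRb0 hRb hosc hFX hhs (δ := 0.007) (by norm_num) hY0 hY hx₀ hx₀cc (f₁ := 61 / 100) (f₂ := 3 / 4)
    (r := 13 / 40) (e := 39 / 400) (q := 1977 / 10000) (ℓ₀ := 0.356671) (by norm_num) hf1 hf2 (by norm_num) (by norm_num) (by norm_num)
    (by norm_num) (by norm_num) (by norm_num) (by norm_num) (by norm_num) hlog (by norm_num) (by norm_num)

/-- **Far descent, interval `[3/4, 1]`, quantitative** (gap `0.007·hs`). [folklore] -/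
theorem far_piece_ge_3 {hs L cc : ℝ} {F : ℂ → (Fin 3 → ℂ)}
    (hF : DifferentiableOn ℂ F {z : ℂ | |z.im| < hs ∧ |z.re - cc| < L + hs})
    (hM : ∀ z ∈ {z : ℂ | |z.im| < hs ∧ |z.re - cc| < L + hs}, ‖deriv F z‖ ≤ 2)
    (hunit : ∀ w ∈ {z : ℂ | |z.im| < hs ∧ |z.re - cc| < L + hs}, ∑ i, (deriv F w i) ^ 2 = 1)
    {X : ℝ → EuclideanSpace ℝ (Fin 3)} (hX : ContDiff ℝ 1 X) (hXu : ∀ τ, ‖deriv X τ‖ = 1)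
    {Rb : ℝ} (hRb0 : 0 ≤ Rb) (hRb : Rb ≤ 1 / 2) (hosc : ∀ τ σ, ‖deriv X τ - deriv X σ‖ ≤ Rb)
    (hFX : ∀ r : ℝ, (r : ℂ) ∈ {z : ℂ | |z.im| < hs ∧ |z.re - cc| < L + hs} →
      F r = fun i => ((⟪X r, EuclideanSpace.single i (1:ℝ)⟫_ℝ : ℝ) : ℂ))
    (hhs : 0 < hs) {x₀ Y f : ℝ} (hY0 : 0 ≤ Y) (hY : Y < hs / 4) (hx₀ : x₀ < cc + L + hs / 4) (hx₀cc : cc ≤ x₀)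
    (hf1 : 3 / 4 ≤ f) (hf2 : f ≤ 1) :
    (0.007 * hs) ^ 2 ≤ (∑ i, (F (((x₀ + (hs / 5 + 3 * hs / 10 * f) : ℝ) : ℂ) + ((Y * (1 - f) : ℝ) : ℂ) * Complex.I) i -
        F ((x₀ : ℂ) + (Y : ℂ) * Complex.I) i) ^ 2).re := by
  have hlog : (0.28767 : ℝ) ≤ Real.log ((1 / 4 : ℝ) / (1 / 4 - 1 / 16)) := by
    have h := partial_sum_le_log_div (R := (1 / 4 : ℝ)) (t := 1 / 16) (by norm_num) (by norm_num) 8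
    simp only [Finset.sum_range_succ, Finset.sum_range_zero] at h
    norm_num at h ⊢; linarith
  exact far_piece_ge hF hM hunit hX hXu hRb0 hRb hosc hFX hhs (δ := 0.007) (by norm_num) hY0 hY hx₀ hx₀cc (f₁ := 3 / 4) (f₂ := 1)
    (r := 1 / 4) (e := 1 / 16) (q := 1 / 4) (ℓ₀ := 0.28767) (by norm_num) hf1 hf2 (by norm_num) (by norm_num) (by norm_num)
    (by norm_num) (by norm_num) (by norm_num) (by norm_num) (by norm_num) hlog (by norm_num) (by norm_num)

/-- **The far descent sources of the right corner, QUANTITATIVE**: for `11/20 ≤ f ≤ 1`,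
`(0.007·hs)² ≤ Re Σᵢ (Fᵢ(ζ(f)) − Fᵢ(z))²` (setting of `Theorems.StadiumCornerRightDescentFar.corner_right_descent_far_re_pos`). [folklore] -/
theorem corner_right_descent_far_re_ge {hs L cc : ℝ} {F : ℂ → (Fin 3 → ℂ)}
    (hF : DifferentiableOn ℂ F {z : ℂ | |z.im| < hs ∧ |z.re - cc| < L + hs})
    (hM : ∀ z ∈ {z : ℂ | |z.im| < hs ∧ |z.re - cc| < L + hs}, ‖deriv F z‖ ≤ 2)
    (hunit : ∀ w ∈ {z : ℂ | |z.im| < hs ∧ |z.re - cc| < L + hs}, ∑ i, (deriv F w i) ^ 2 = 1)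
    {X : ℝ → EuclideanSpace ℝ (Fin 3)} (hX : ContDiff ℝ 1 X) (hXu : ∀ τ, ‖deriv X τ‖ = 1)
    {Rb : ℝ} (hRb0 : 0 ≤ Rb) (hRb : Rb ≤ 1 / 2) (hosc : ∀ τ σ, ‖deriv X τ - deriv X σ‖ ≤ Rb)
    (hFX : ∀ r : ℝ, (r : ℂ) ∈ {z : ℂ | |z.im| < hs ∧ |z.re - cc| < L + hs} →
      F r = fun i => ((⟪X r, EuclideanSpace.single i (1:ℝ)⟫_ℝ : ℝ) : ℂ))
    (hhs : 0 < hs) {x₀ Y f : ℝ} (hY0 : 0 ≤ Y) (hY : Y < hs / 4) (hx₀ : x₀ < cc + L + hs / 4) (hx₀cc : cc ≤ x₀)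
    (hf1 : 11 / 20 ≤ f) (hf2 : f ≤ 1) :
    (0.007 * hs) ^ 2 ≤ (∑ i, (F (((x₀ + (hs / 5 + 3 * hs / 10 * f) : ℝ) : ℂ) + ((Y * (1 - f) : ℝ) : ℂ) * Complex.I) i -
        F ((x₀ : ℂ) + (Y : ℂ) * Complex.I) i) ^ 2).re := by
  rcases le_total f (61 / 100) with h1 | h1
  · exact far_piece_ge_1 hF hM hunit hX hXu hRb0 hRb hosc hFX hhs hY0 hY hx₀ hx₀cc hf1 h1
  rcases le_total f (3 / 4) with h2 | h2
  exacts [far_piece_ge_2 hF hM hunit hX hXu hRb0 hRb hosc hFX hhs hY0 hY hx₀ hx₀cc h1 h2,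
    far_piece_ge_3 hF hM hunit hX hXu hRb0 hRb hosc hFX hhs hY0 hY hx₀ hx₀cc h2 hf2]
end Summit.NavierStokesRegularity.NavierStokesRegularity.Theorems.StadiumCornerQuantFeet

end
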